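import Summits.CriticalPhenomena.PercolationContinuityZ3.Theorems.Transplant.SkelPhiRectPrism
import Summits.CriticalPhenomena.PercolationContinuityZ3.Theorems.Transplant.SkelPhiRectAt
import Summits.CriticalPhenomena.PercolationContinuityZ3.Theorems.Transplant.SkelPhiFatRadius
import Summits.CriticalPhenomena.PercolationContinuityZ3.Theorems.Transplant.TwoAxisWindowTransfer
import HarnessLib

/-!
# D″ node, STRUCTURE-FREE layer L5′.2 (V98 p3 column; P4-GENERAL §16.2 (i), §16.6): LEMMA 9′ IN KIT VOCABULARY — every LEVEL-0 certificate for the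
# rectangle-cylinder `R(a₀, a₁)` at a vertex `t` (both axes / directed sides / side-halves / threshold pieces / the band, all stated on
# `TwoAxis.rect (relCoord φ t 0) (relCoord φ t 1)` with Φ2 in event form) becomes a LOWER BOUND for the kit event
# `KNLevels.linkIn (rectPrism t a R) (cylBallFin t m r) (rside / rhalf …)` inside the FAT rectangle, up to the cylinder-tail
# `P(⋃_{b ∈ seed} cylReach t (amax a) (R − 1) b)` — which is `≤ 2^{−amax a}` when `R = fatRadius (amax a)` and the seed sits one level down

builds on p205010 (kernel theorem, internal audit signed; external expert review pending) — nothing in this file uses p205010.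
Lane `prim-bschramm`, seat `prim-bschramm-p3` (gen 7; D″ design owner); helper file (`--supports stmt-CriticalPhenomena-4575`).
This replaces `SkelQuarterFaces`/`SkelLinkedFace` (Lemma 9 for the node of record: the eight quarter-pieces of the SQUARE fat prism under `D₄`,
certified by "θ_B ≤ P(⋃ pieces) + fibre tail" and the `1/8` square-root trick).  Here the shape is the `p`-dependent band rectangle, the symmetry is
`(ℤ/2)²` (or `{±1}`), and the certification is modular: LEVEL 0 (files `TwoAxis*`) bounds the INFINITE-cylinder event, `TwoAxisWindowTransfer`
moves it into the window `W = cylBall t (amax a) R` at the cost of the fibre-exit event `WExitR`, and §3 here identifies `WExitR` with the node's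
cylinder tail.  Hypotheses via the dictionary (`Steps`, `CylConn`, `Frames`, Φ2 = `CylSubcritical`); point-group elements never enter this file
(they enter LEVEL 0 through `SkelPhiPointGroup`'s adapters).
* §1 the seed `B = cylBallFin t m r` at a base vertex: `rect_relCoord_eq_cyl`, `cylBallFin_subset_rect`, **`exists_mem_cylBallFin_relCoord_eq`** (`Steps` +
  (κ) at `t`: `B` meets the lines `α = m` and `β = m` once `r ≥ cylRad t m m`), `cylBallFin_subset_cylBall`;
* §2 Φ2 in LEVEL 0's event form: **`real_percolatesVia_rect_eq_zero`** (`Frames` + Φ2: no seed vertex percolates inside `R(n, n) = cyl t n`);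
* §3 the fibre exit IS a cylinder tail: **`wExitR_cylBall_subset_biUnion_cylReach`** (`W = cylBall t n (R+1)`, `aᵢ ≤ n`:
  `WExitR ⊆ ⋃_{b ∈ B} cylReach t n R b`), `real_wExitR_cylBall_le`;
* §4 **kit events from LEVEL-0 events**: `linkIn_rhalf_zero / one` (bridges for halves, = `SideHalfHitW / TopHalfHitW`),
  **`real_linkIn_rside_zero_ge`**, `real_linkIn_rside_one_ge`, `real_linkIn_rhalf_zero_ge`, `real_linkIn_rhalf_one_ge`:
  `P(SideHit σ) − P(⋃ cylReach) ≤ P(linkIn (rectPrism t a (R+1)) B (rside t a (R+1) 0 σ))` etc.;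
* §5 **with the fat radius** (`R + 1 = fatRadius hfr hC n`, `n = amax a ≥ 1`, seed `⊆ fatSeq t (n−1)`, `t ∈ types`): `real_biUnion_cylReach_fat_le`
  (the tail is `≤ 2^{−n}`) and **`real_linkIn_rside_fat_ge`** / **`real_linkIn_rhalf_fat_ge`** — the form Step I′ tabulates.
[cite: KozmaNitzan2024, §4 Lemma 9 p. 16 (quarter faces; "hittable geometry"), p. 20 ((22)–(23))] [cite: GrimmettPercolation1999, §7.3 Lemma (7.36), p. 169]
[cite: MartineauSevero2019, Cor. 2.2 (input Φ2)]
-/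

noncomputable section

open MeasureTheory

namespace Summit.CriticalPhenomena.PercolationContinuityZ3.Theorems.Transplant

namespace Skelφ

open Literature.Probability.Percolation Literature.Probability.LatticeModels SimpleGraph KNLevels
open Literature.Probability.Percolation.GM
open Literature.Probability.Percolation.KozmaNitzan.Cells (oth oth_ne oth_oth)
open Literature.Barriers.CriticalPhenomena (graphBall graphBall_finite mem_graphBall_self graphBall_mono mem_graphBall_map)
open scoped Classical

variable {V : Type} {G : SimpleGraph V} [G.LocallyFinite] {φ : V → Site 2}

/-! ## §1 The seed at a base vertex -/

variable (G φ) in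
/-- The square rectangle-cylinder of the relative coordinates is the cylinder: `R(n, n) = cyl t n`. [folklore] -/
theorem rect_relCoord_eq_cyl (t : V) (n : ℕ) : TwoAxis.rect (relCoord φ t 0) (relCoord φ t 1) n n = cyl φ t n := by
  ext w
  simp only [TwoAxis.rect, relCoord_apply, Set.mem_setOf_eq, mem_cyl, mem_box, Fin.forall_fin_two, Pi.sub_apply]

variable (G φ) in
/-- The seed `cylBallFin t m r` lies in the square `R(m, m)`. [folklore] -/
theorem cylBallFin_subset_rect (t : V) (m r : ℕ) :
    (↑(cylBallFin G φ t m r) : Set V) ⊆ TwoAxis.rect (relCoord φ t 0) (relCoord φ t 1) m m := by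
  intro b hb
  rw [rect_relCoord_eq_cyl]
  exact cylBall_subset_cyl G φ t m r ((mem_cylBallFin G φ).1 hb)

variable (G φ) in
/-- The seed at scale `m` lies in every larger fat prism (`m ≤ n`, `r ≤ R`). [folklore] -/
theorem cylBallFin_subset_cylBall (t : V) {m n r R : ℕ} (hmn : m ≤ n) (hrR : r ≤ R) :
    (↑(cylBallFin G φ t m r) : Set V) ⊆ cylBall G φ t n R := fun _ hb =>
  cylBall_mono G φ t hmn hrR ((mem_cylBallFin G φ).1 hb)

/-- **The seed touches the line `α = m` and the line `β = m`** (`Steps` reach `φ t + (m, 0)` and `φ t + (0, m)` inside `B_G(t, m) ∩ cyl t m`, hence inside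
the fat prism of radius `cylRad t m m` by (κ) at `t`), once `r ≥ cylRad t m m`. [cite: KozmaNitzan2024, §4 p. 26 ((29))] -/
theorem exists_mem_cylBallFin_relCoord_eq (hstep : Steps G φ) {t : V} {m : ℕ} (hκt : (G.induce (cyl φ t m)).Connected) {r : ℕ}
    (hr : cylRad G φ t m m ≤ r) :
    (∃ b ∈ (↑(cylBallFin G φ t m r) : Set V), relCoord φ t 0 b = m ∨ relCoord φ t 0 b = -(m : ℤ)) ∧
      (∃ b ∈ (↑(cylBallFin G φ t m r) : Set V), relCoord φ t 1 b = m ∨ relCoord φ t 1 b = -(m : ℤ)) := by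
  have key : ∀ i j : ℕ, i + j ≤ m → ∃ b ∈ (↑(cylBallFin G φ t m r) : Set V), φ b = φ t + ![(i : ℤ), (j : ℤ)] := by
    intro i j hij
    obtain ⟨g, hg, hφ⟩ := exists_mem_graphBall_φ_eq hstep t (φ t + ![(i : ℤ), (j : ℤ)])
    have hg' : g ∈ graphBall G t m := by
      refine graphBall_mono G t ?_ hg
      simp
      omega
    have hcyl : g ∈ cyl φ t m := by
      rw [mem_cyl, hφ, add_sub_cancel_left, mem_box]
      intro k
      fin_cases k <;> simp <;> omega
    have hball : g ∈ cylBall G φ t m r := cylBall_mono G φ t le_rfl hr (graphBall_inter_cyl_subset_cylBall hκt m ⟨hg', hcyl⟩)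
    exact ⟨g, by simpa using hball, hφ⟩
  constructor
  · obtain ⟨b, hb, hφ⟩ := key m 0 (by omega)
    exact ⟨b, hb, Or.inl (by simp [relCoord, hφ])⟩
  · obtain ⟨b, hb, hφ⟩ := key 0 m (by omega)
    exact ⟨b, hb, Or.inl (by simp [relCoord, hφ])⟩

/-! ## §2 Φ2 in the event form LEVEL 0 consumes -/

/-- **No seed vertex percolates inside `R(n, n) = cyl t n`** (`Frames` + Φ2, `m ≤ n`). [cite: MartineauSevero2019, Cor. 2.2] -/
theorem real_percolatesVia_rect_eq_zero [Countable V] {types : Finset V} (hfr : Frames G φ types) {p : unitInterval}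
    (hC : CylSubcritical G φ types p) (t : V) {m n : ℕ} (hmn : m ≤ n) (r : ℕ) :
    ∀ b ∈ (↑(cylBallFin G φ t m r) : Set V),
      (bondPercolation G p).real (percolatesVia (withinGraph ⊤ (TwoAxis.rect (relCoord φ t 0) (relCoord φ t 1) n n)) b) = 0 := by
  intro b hb
  rw [rect_relCoord_eq_cyl]
  have hbm : b ∈ cyl φ t m := cylBall_subset_cyl G φ t m r ((mem_cylBallFin G φ).1 hb)
  exact prob_percolatesVia_cyl_eq_zero hfr hC (cyl_mono φ t hmn hbm)

/-! ## §3 The fibre exit from a fat-prism window is a cylinder tail -/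

omit [G.LocallyFinite] in
/-- **`WExitR` for the window `cylBall t n (R+1)` is a cylinder-tail event**: if `B` is joined inside `R(ℓ₁,ℓ₂) ∩ cylBall t n (R+1)` (`ℓᵢ ≤ n`) to a
vertex `z` with a neighbour `u ∈ R(ℓ₁,ℓ₂) ∖ cylBall t n (R+1)`, then `z ∉ cylBall t n R` (else `u ∈ cylBall t n (R+1)`), so the cluster of some
`b ∈ B` inside `cyl t n` reaches `cylFar t n R`. [cite: KozmaNitzan2024, §4 p. 20 ((22)–(23))] -/
theorem wExitR_cylBall_subset_biUnion_cylReach {t : V} {n ℓ₁ ℓ₂ R : ℕ} (h₁ : ℓ₁ ≤ n) (h₂ : ℓ₂ ≤ n) (B : Finset V) :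
    TwoAxis.WExitR G (relCoord φ t 0) (relCoord φ t 1) (cylBall G φ t n (R + 1)) ↑B ℓ₁ ℓ₂ ⊆ ⋃ b ∈ B, cylReach G φ t n R b := by
  rintro ω ⟨b, hb, z, ⟨u, huR, huW, hzu⟩, hbz⟩
  have hRn : TwoAxis.rect (relCoord φ t 0) (relCoord φ t 1) ℓ₁ ℓ₂ ⊆ cyl φ t n := by
    rw [← rect_relCoord_eq_cyl]; exact TwoAxis.rect_mono _ _ h₁ h₂
  have hWn : TwoAxis.rectW (relCoord φ t 0) (relCoord φ t 1) (cylBall G φ t n (R + 1)) ℓ₁ ℓ₂ ⊆ cyl φ t n := fun w hw => hRn hw.1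
  have hbW : b ∈ TwoAxis.rectW (relCoord φ t 0) (relCoord φ t 1) (cylBall G φ t n (R + 1)) ℓ₁ ℓ₂ := by
    obtain ⟨h, _, _⟩ := hbz; exact h
  have hzW : z ∈ TwoAxis.rectW (relCoord φ t 0) (relCoord φ t 1) (cylBall G φ t n (R + 1)) ℓ₁ ℓ₂ := by
    obtain ⟨_, h, _⟩ := hbz; exact h
  simp only [Set.mem_iUnion, exists_prop]
  refine ⟨b, hb, z, ⟨⟨R + 1, hzW.2⟩, fun hzR => huW ?_⟩, ?_⟩
  · exact mem_cylBall_succ_of_adj G φ t le_rfl hzR hzu (hRn huR)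
  · rw [openConnIn_eq_openConnVia hbW] at hbz
    exact openClusterIn_mono_graph (withinGraph_mono _ hWn) ω b hbz

omit [G.LocallyFinite] in
/-- The probability form. [folklore] -/
theorem real_wExitR_cylBall_le [Countable V] (p : unitInterval) {t : V} {n ℓ₁ ℓ₂ R : ℕ} (h₁ : ℓ₁ ≤ n) (h₂ : ℓ₂ ≤ n) (B : Finset V) :
    (bondPercolation G p).real (TwoAxis.WExitR G (relCoord φ t 0) (relCoord φ t 1) (cylBall G φ t n (R + 1)) ↑B ℓ₁ ℓ₂) ≤
      (bondPercolation G p).real (⋃ b ∈ B, cylReach G φ t n R b) :=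
  measureReal_mono (wExitR_cylBall_subset_biUnion_cylReach h₁ h₂ B) (measure_ne_top _ _)

/-! ## §4 Kit events from LEVEL-0 events -/

variable (G φ) in
/-- **Bridge for halves, `0`-facing**: `linkIn` to a side-half inside the fat rectangle is the windowed side-half event. [folklore] -/
theorem linkIn_rhalf_zero (t : V) (a : Fin 2 → ℕ) (R : ℕ) (B : Finset V) (σ τ : ℤ) :
    linkIn (rectPrism G φ t a R) B (rhalf G φ t a R 0 σ τ) =
      TwoAxis.SideHalfHitW (relCoord φ t 0) (relCoord φ t 1) (cylBall G φ t (amax a) R) ↑B σ τ (a 0) (a 1) := by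
  rw [linkIn_eq_openCrossing, coe_rhalf_zero, TwoAxis.SideHalfHitW, ← rectPrism_eq_rectW, openCrossing_inter_eq]

variable (G φ) in
/-- **Bridge for halves, `1`-facing.** [folklore] -/
theorem linkIn_rhalf_one (t : V) (a : Fin 2 → ℕ) (R : ℕ) (B : Finset V) (σ τ : ℤ) :
    linkIn (rectPrism G φ t a R) B (rhalf G φ t a R 1 σ τ) =
      TwoAxis.TopHalfHitW (relCoord φ t 0) (relCoord φ t 1) (cylBall G φ t (amax a) R) ↑B σ τ (a 0) (a 1) := by
  rw [linkIn_eq_openCrossing, coe_rhalf_one, TwoAxis.TopHalfHitW, ← rectPrism_eq_rectW, openCrossing_inter_eq]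

/-- **Kit event from the directed-side event, `0`-facing**: for a seed `B ⊆ cylBall t (amax a) (R+1)`,
`P(SideHit σ on R(a₀,a₁)) − P(⋃_{b∈B} cylReach t (amax a) R b) ≤ P(linkIn (rectPrism t a (R+1)) B (rside t a (R+1) 0 σ))`.
[cite: KozmaNitzan2024, §4 Lemma 9 p. 16] -/
theorem real_linkIn_rside_zero_ge [Countable V] (p : unitInterval) {t : V} (a : Fin 2 → ℕ) (R : ℕ) {B : Finset V}
    (hBW : (↑B : Set V) ⊆ cylBall G φ t (amax a) (R + 1)) (σ : ℤ) :
    (bondPercolation G p).real (TwoAxis.SideHit (relCoord φ t 0) (relCoord φ t 1) ↑B σ (a 0) (a 1)) -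
        (bondPercolation G p).real (⋃ b ∈ B, cylReach G φ t (amax a) R b) ≤
      (bondPercolation G p).real (linkIn (rectPrism G φ t a (R + 1)) B (rside G φ t a (R + 1) 0 σ)) := by
  rw [linkIn_rside_zero]
  have h1 := TwoAxis.real_sideHit_le_window G p (α := relCoord φ t 0) (β := relCoord φ t 1) hBW σ (a 0) (a 1)
  have h2 := real_wExitR_cylBall_le (G := G) (φ := φ) p (t := t) (R := R) (le_amax a 0) (le_amax a 1) B
  linarith

/-- **Kit event from the directed-top event, `1`-facing.** [cite: KozmaNitzan2024, §4 Lemma 9 p. 16] -/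
theorem real_linkIn_rside_one_ge [Countable V] (p : unitInterval) {t : V} (a : Fin 2 → ℕ) (R : ℕ) {B : Finset V}
    (hBW : (↑B : Set V) ⊆ cylBall G φ t (amax a) (R + 1)) (σ : ℤ) :
    (bondPercolation G p).real (TwoAxis.TopHit (relCoord φ t 0) (relCoord φ t 1) ↑B σ (a 0) (a 1)) -
        (bondPercolation G p).real (⋃ b ∈ B, cylReach G φ t (amax a) R b) ≤
      (bondPercolation G p).real (linkIn (rectPrism G φ t a (R + 1)) B (rside G φ t a (R + 1) 1 σ)) := by
  rw [linkIn_rside_one]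
  have h1 := TwoAxis.real_topHit_le_window G p (α := relCoord φ t 0) (β := relCoord φ t 1) hBW σ (a 0) (a 1)
  have h2 := real_wExitR_cylBall_le (G := G) (φ := φ) p (t := t) (R := R) (le_amax a 0) (le_amax a 1) B
  linarith

/-- **Kit event from the side-half event, `0`-facing.** [cite: KozmaNitzan2024, §4 Lemma 9 p. 16 (quarter faces)] -/
theorem real_linkIn_rhalf_zero_ge [Countable V] (p : unitInterval) {t : V} (a : Fin 2 → ℕ) (R : ℕ) {B : Finset V}
    (hBW : (↑B : Set V) ⊆ cylBall G φ t (amax a) (R + 1)) (σ τ : ℤ) :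
    (bondPercolation G p).real (TwoAxis.SideHalfHit (relCoord φ t 0) (relCoord φ t 1) ↑B σ τ (a 0) (a 1)) -
        (bondPercolation G p).real (⋃ b ∈ B, cylReach G φ t (amax a) R b) ≤
      (bondPercolation G p).real (linkIn (rectPrism G φ t a (R + 1)) B (rhalf G φ t a (R + 1) 0 σ τ)) := by
  rw [linkIn_rhalf_zero]
  have h1 := TwoAxis.real_sideHalfHit_le_window G p (α := relCoord φ t 0) (β := relCoord φ t 1) hBW σ τ (a 0) (a 1)
  have h2 := real_wExitR_cylBall_le (G := G) (φ := φ) p (t := t) (R := R) (le_amax a 0) (le_amax a 1) B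
  linarith

/-- **Kit event from the top-half event, `1`-facing.** [cite: KozmaNitzan2024, §4 Lemma 9 p. 16 (quarter faces)] -/
theorem real_linkIn_rhalf_one_ge [Countable V] (p : unitInterval) {t : V} (a : Fin 2 → ℕ) (R : ℕ) {B : Finset V}
    (hBW : (↑B : Set V) ⊆ cylBall G φ t (amax a) (R + 1)) (σ τ : ℤ) :
    (bondPercolation G p).real (TwoAxis.TopHalfHit (relCoord φ t 0) (relCoord φ t 1) ↑B σ τ (a 0) (a 1)) -
        (bondPercolation G p).real (⋃ b ∈ B, cylReach G φ t (amax a) R b) ≤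
      (bondPercolation G p).real (linkIn (rectPrism G φ t a (R + 1)) B (rhalf G φ t a (R + 1) 1 σ τ)) := by
  rw [linkIn_rhalf_one]
  have h1 := TwoAxis.real_topHalfHit_le_window G p (α := relCoord φ t 0) (β := relCoord φ t 1) hBW σ τ (a 0) (a 1)
  have h2 := real_wExitR_cylBall_le (G := G) (φ := φ) p (t := t) (R := R) (le_amax a 0) (le_amax a 1) B
  linarith

/-! ## §5 With the fat radius: the tail is `2^{−n}` -/

/-- **The fibre tail at the fat radius**: at a base vertex, for `n ≥ 1`, `R + 1 = ψ n` and a seed `B ⊆ fatSeq t (n−1)`, the tail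
`P(⋃_{b∈B} cylReach t n R b) ≤ 2^{−n}` (the defining estimate of the fat radius, one level down). [folklore] -/
theorem real_biUnion_cylReach_fat_le [Countable V] {types : Finset V} (hfr : Frames G φ types) {p : unitInterval}
    (hC : CylSubcritical G φ types p) {t : V} (ht : t ∈ types) {n : ℕ} (hn : 1 ≤ n) {B : Finset V}
    (hB : B ⊆ fatSeq hfr hC t (n - 1)) :
    (bondPercolation G p).real (⋃ b ∈ B, cylReach G φ t n (fatRadius hfr hC n - 1) b) ≤ (1 / 2 : ℝ) ^ n := by
  obtain ⟨k, rfl⟩ : ∃ k, n = k + 1 := ⟨n - 1, by omega⟩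
  have hfat := prob_cylReach_fat_le hfr hC ht k
  simp only [Nat.add_sub_cancel] at hB ⊢
  refine le_trans (measureReal_mono ?_ (measure_ne_top _ _)) hfat
  exact Set.biUnion_subset_biUnion_left fun b hb => hB hb

/-- **Lemma 9′ in kit vocabulary, directed sides** (the form Step I′ tabulates): at a base vertex `t`, for half-widths `a` with `n := amax a ≥ 1`, fat radius
`ψ = fatRadius hfr hC`, and a seed `B ⊆ fatSeq t (n−1)`:
`P(SideHit σ on R(a₀,a₁)) − 2^{−n} ≤ P(linkIn (rectPrism t a (ψ n)) B (rside t a (ψ n) 0 σ))`, and the same with `TopHit` / `1`-facing sides.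
[cite: KozmaNitzan2024, §4 Lemma 9 p. 16] -/
theorem real_linkIn_rside_fat_ge [Countable V] {types : Finset V} (hfr : Frames G φ types) {p : unitInterval} (hC : CylSubcritical G φ types p)
    {t : V} (ht : t ∈ types) (a : Fin 2 → ℕ) (hn : 1 ≤ amax a) {B : Finset V} (hB : B ⊆ fatSeq hfr hC t (amax a - 1)) (σ : ℤ) :
    (bondPercolation G p).real (TwoAxis.SideHit (relCoord φ t 0) (relCoord φ t 1) ↑B σ (a 0) (a 1)) - (1 / 2 : ℝ) ^ amax a ≤
        (bondPercolation G p).real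
          (linkIn (rectPrism G φ t a (fatRadius hfr hC (amax a))) B (rside G φ t a (fatRadius hfr hC (amax a)) 0 σ)) ∧
      (bondPercolation G p).real (TwoAxis.TopHit (relCoord φ t 0) (relCoord φ t 1) ↑B σ (a 0) (a 1)) - (1 / 2 : ℝ) ^ amax a ≤
        (bondPercolation G p).real
          (linkIn (rectPrism G φ t a (fatRadius hfr hC (amax a))) B (rside G φ t a (fatRadius hfr hC (amax a)) 1 σ)) := by
  set n := amax a with hn'
  have hψ : fatRadius hfr hC n - 1 + 1 = fatRadius hfr hC n := by
    have := le_fatRadius hfr hC n; omega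
  have hBW : (↑B : Set V) ⊆ cylBall G φ t n (fatRadius hfr hC n - 1 + 1) := by
    rw [hψ]
    intro b hb
    have hb' := (mem_fatSeq_iff hfr hC).1 (hB (Finset.mem_coe.1 hb))
    exact cylBall_mono G φ t (Nat.sub_le n 1) (fatRadius_mono hfr hC (Nat.sub_le n 1)) hb'
  have htail := real_biUnion_cylReach_fat_le hfr hC ht hn hB
  have h0 := real_linkIn_rside_zero_ge (φ := φ) p a (fatRadius hfr hC n - 1) hBW σ
  have h1 := real_linkIn_rside_one_ge (φ := φ) p a (fatRadius hfr hC n - 1) hBW σ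
  rw [hψ] at h0 h1
  exact ⟨by linarith, by linarith⟩

/-- **Lemma 9′ in kit vocabulary, side-halves.** [cite: KozmaNitzan2024, §4 Lemma 9 p. 16 (quarter faces)] -/
theorem real_linkIn_rhalf_fat_ge [Countable V] {types : Finset V} (hfr : Frames G φ types) {p : unitInterval} (hC : CylSubcritical G φ types p)
    {t : V} (ht : t ∈ types) (a : Fin 2 → ℕ) (hn : 1 ≤ amax a) {B : Finset V} (hB : B ⊆ fatSeq hfr hC t (amax a - 1)) (σ τ : ℤ) :
    (bondPercolation G p).real (TwoAxis.SideHalfHit (relCoord φ t 0) (relCoord φ t 1) ↑B σ τ (a 0) (a 1)) - (1 / 2 : ℝ) ^ amax a ≤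
        (bondPercolation G p).real
          (linkIn (rectPrism G φ t a (fatRadius hfr hC (amax a))) B (rhalf G φ t a (fatRadius hfr hC (amax a)) 0 σ τ)) ∧
      (bondPercolation G p).real (TwoAxis.TopHalfHit (relCoord φ t 0) (relCoord φ t 1) ↑B σ τ (a 0) (a 1)) - (1 / 2 : ℝ) ^ amax a ≤
        (bondPercolation G p).real
          (linkIn (rectPrism G φ t a (fatRadius hfr hC (amax a))) B (rhalf G φ t a (fatRadius hfr hC (amax a)) 1 σ τ)) := by
  set n := amax a with hn'
  have hψ : fatRadius hfr hC n - 1 + 1 = fatRadius hfr hC n := by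
    have := le_fatRadius hfr hC n; omega
  have hBW : (↑B : Set V) ⊆ cylBall G φ t n (fatRadius hfr hC n - 1 + 1) := by
    rw [hψ]
    intro b hb
    have hb' := (mem_fatSeq_iff hfr hC).1 (hB (Finset.mem_coe.1 hb))
    exact cylBall_mono G φ t (Nat.sub_le n 1) (fatRadius_mono hfr hC (Nat.sub_le n 1)) hb'
  have htail := real_biUnion_cylReach_fat_le hfr hC ht hn hB
  have h0 := real_linkIn_rhalf_zero_ge (φ := φ) p a (fatRadius hfr hC n - 1) hBW σ τ
  have h1 := real_linkIn_rhalf_one_ge (φ := φ) p a (fatRadius hfr hC n - 1) hBW σ τ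
  rw [hψ] at h0 h1
  exact ⟨by linarith, by linarith⟩

end Skelφ

end Summit.CriticalPhenomena.PercolationContinuityZ3.Theorems.Transplant

end
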